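import Summits.AtomisticToContinuum.HydrodynamicLimit.Theses.RelayRaceLocality
import Summits.AtomisticToContinuum.HydrodynamicLimit.Theses.ResponseRigidity
import HarnessLib

/-!
# Crux `RestartPrinciple` (stmt-AtomisticToContinuum-12503) — glue against the re-typed sub-problem decl

Support file (`--supports stmt-AtomisticToContinuum-12503`; line `IdeatorFourSketch`, lead c10). The crux decl
`RelayRaceLocality.RestartPrinciple` is literally `S → G` with `G` VERBATIM the body of the (re-typed 2026-08-16, p126922,
packing-guarded) sub-problem decl `_root_.HydrodynamicLimit`. The glue previously landed for this crux was phrased through the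
route decl `GermanoSplitLES.HydroLimitInBand` (stmt-AtomisticToContinuum-9133), which route-repair GermanoSplitLES rev 5 dropped,
so `Theorems/RelayRaceLocalityRestartPrincipleReduction.lean` (p108006: `restartPrinciple_of_hydroLimitInBand`,
`restartPrinciple_of_guardedConjunct`) and `Theorems/RelayRaceLocalityRestartPrincipleMeanOfGuardedConjunct.lean` (p128777) no
longer elaborate. This file re-lands the glue against `_root_.HydrodynamicLimit` and the items of route `ResponseRigidity` that
line `IdeatorFourSketch` uses as stubs (registered skeleton v3, `Cruxes/RestartPrinciple/Lines/IdeatorFourSketch.lean`):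

* `restartPrinciple_of_hydrodynamicLimit : HydrodynamicLimit → RestartPrinciple` (the antecedent `S` is discarded — necessarily:
  `RestartPrincipleNegative.prefixMfirst_schema_false`, p99454);
* `hydrodynamicLimit_of_meanProgramme : MeanHydroLimitInBand → MeanClosure → HydrodynamicLimit` (the dock = the body of
  `ResponseRigidity.closes`: `η₀ := min η₁ η₂`, `σ₀ := min σ₁ σ₂`, the conjunct's packing guard feeds both item guards);
* `restartPrinciple_of_meanProgramme : MeanHydroLimitInBand → MeanClosure → RestartPrinciple`;
* `restartPrinciple_of_meansByCharacteristics : MeansByCharacteristics → FlowBoxDecoupling → MeanMapRegularity →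
  EulerProfileFamily → MeanClosure → RestartPrinciple` — the composition of skeleton v3 with every stub a hypothesis; with
  `MeansByCharacteristics` (p128457), `EulerProfileFamily` (p127927) and `MeanClosure` (p128739) proved under this crux it reads
  `RestartPrinciple ⟸ FlowBoxDecoupling (stmt-15329) ∧ MeanMapRegularity (stmt-15330)`.
Pure quantifier bookkeeping; no definitions. References: H. Spohn (1991) Part I Ch. 3; S. Olla – S.R.S. Varadhan – H.-T. Yau (1993) §1.
-/

namespace Summit.AtomisticToContinuum.HydrodynamicLimit.Theorems.RestartPrinciple

open Summit.AtomisticToContinuum.HydrodynamicLimit.Theses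
open Summit.AtomisticToContinuum.HydrodynamicLimit.Theses.RelayRaceLocality

/-- **The packing-guarded sub-problem decl implies the crux.** The consequent of `RestartPrinciple` is verbatim the body of
`_root_.HydrodynamicLimit` (statement re-type p126922); the antecedent `S` (short-time guarded limit from local-Gibbs time-0 data)
is discarded. Replaces `restartPrinciple_of_hydroLimitInBand` / `restartPrinciple_of_guardedConjunct` (p108006), phrased through the
dropped decl `GermanoSplitLES.HydroLimitInBand`. -/
theorem restartPrinciple_of_hydrodynamicLimit : _root_.HydrodynamicLimit → RelayRaceLocality.RestartPrinciple :=
  fun hG _ => hG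

/-- **The dock of line `IdeatorFourSketch`**: the MEAN hydrodynamic limit in the dilute band (stmt-AtomisticToContinuum-11927
`ResponseRigidity.MeanHydroLimitInBand`) and the entropy-saturated MEAN CLOSURE (stmt-AtomisticToContinuum-11929
`ResponseRigidity.MeanClosure`) imply the packing-guarded conjunct. Quantifier bookkeeping only (`η₀ := min η₁ η₂`,
`σ₀ := min σ₁ σ₂`; the conjunct's own packing guard, a hypothesis since the re-type, feeds both items' guards) — the body of
`ResponseRigidity.closes`. -/
theorem hydrodynamicLimit_of_meanProgramme : ResponseRigidity.MeanHydroLimitInBand → ResponseRigidity.MeanClosure → _root_.HydrodynamicLimit := by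
  rintro ⟨η₁, hη₁, H₁⟩ ⟨η₂, hη₂, H₂⟩
  refine ⟨min η₁ η₂, lt_min hη₁ hη₂, ?_⟩
  intro a₀ θ₀ u₀ ha hθ hu ha0 hθ0
  obtain ⟨σ₁, hσ₁, G₁⟩ := H₁ a₀ θ₀ u₀ ha hθ hu ha0 hθ0
  obtain ⟨σ₂, hσ₂, G₂⟩ := H₂ a₀ θ₀ u₀ ha hθ hu ha0 hθ0
  refine ⟨min σ₁ σ₂, lt_min hσ₁ hσ₂, ?_⟩
  intro σ hσ hσ' T ρ θ u hE hpack Φ h0 t ht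
  have h1 : σ < σ₁ := lt_of_lt_of_le hσ' (min_le_left _ _)
  have h2 : σ < σ₂ := lt_of_lt_of_le hσ' (min_le_right _ _)
  have hp1 : ∀ s ∈ Set.Ico 0 T, ∀ x, ρ s x * σ ^ 3 < η₁ :=
    fun s hs x => lt_of_lt_of_le (hpack s hs x) (min_le_left _ _)
  have hp2 : ∀ s ∈ Set.Ico 0 T, ∀ x, ρ s x * σ ^ 3 < η₂ :=
    fun s hs x => lt_of_lt_of_le (hpack s hs x) (min_le_right _ _)
  exact G₂ σ hσ h2 T ρ θ u hE hp2 Φ h0 t ht (G₁ σ hσ h1 T ρ θ u hE hp1 Φ h0 t ht)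

/-- **Mean programme ⇒ crux**: `MeanHydroLimitInBand → MeanClosure → RestartPrinciple` (dock, then the glue). With `MeanClosure`
proved under this crux (lead a2, p128739) this is the registered sub-goal `restartPrinciple_of_meanHydroLimitInBand` up to that
input: the crux follows from stmt-AtomisticToContinuum-11927 alone. -/
theorem restartPrinciple_of_meanProgramme : ResponseRigidity.MeanHydroLimitInBand → ResponseRigidity.MeanClosure → RelayRaceLocality.RestartPrinciple :=
  fun hM hC => restartPrinciple_of_hydrodynamicLimit (hydrodynamicLimit_of_meanProgramme hM hC)

/-- **The composition of skeleton v3 of line `IdeatorFourSketch` with every stub a hypothesis**: means by characteristics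
(stmt-15334) applied to the flow-box decoupling (stmt-15329), the mean-map regularity (stmt-15330) and the Euler activity family
(stmt-15331) gives the mean limit (stmt-11927); the dock with the mean closure (stmt-11929) gives the conjunct; the glue gives the
crux. Since stmt-15334 (p128457), stmt-15331 (p127927) and stmt-11929 (p128739) are proved under this crux, the live content is
`RestartPrinciple ⟸ FlowBoxDecoupling ∧ MeanMapRegularity`. -/
theorem restartPrinciple_of_meansByCharacteristics : ResponseRigidity.MeansByCharacteristics → ResponseRigidity.FlowBoxDecoupling → ResponseRigidity.MeanMapRegularity → ResponseRigidity.EulerProfileFamily → ResponseRigidity.MeanClosure → RelayRaceLocality.RestartPrinciple :=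
  fun hMBC hFBD hMMR hEPF hC => restartPrinciple_of_meanProgramme (hMBC hFBD hMMR hEPF) hC

end Summit.AtomisticToContinuum.HydrodynamicLimit.Theorems.RestartPrinciple
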